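import Mathlib
import Summits.CriticalPhenomena.PercolationContinuityZ3.Theorems.PercNearOneGluingNoHeavyLowerTailFallingMesh
import HarnessLib

/-!
# The discrete Routh chain of a gapped interlacing pair exists (THEOREM R^sep, analytic half)

Support file for the Sahi / Conjecture-P programme of route `PercNearOneGluingNoHeavy`
(`--supports stmt-CriticalPhenomena-4575`, prover prim-l12-p5 gen 48; proof note
`prim-l12-p5/PROOF-DIFFERENCE-HURWITZ-g48.md` §2.3).  No definitions, no named facts, no sorries.

`DiffHurwitz.routhChain_exists`: if `p = lp·∏_{i ≤ k}(X - α_i)` and `q̃ = lq·∏_{i<k}(X - γ_i)` with `lp, lq > 0`,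
`α_k < 0` and the gapped interlacing `α_i - 1 < γ_i < α_{i+1} - 1` (invariant J of the memo), then the
discrete Routh algorithm `p₁ = p - (lp/lq)·x·q̃(x-1)`, `q₂ = q̃ - (lq/lp₁)·p₁(x+1)` runs `k+1` rounds with
positive constants and ends at `(κ, 0)` with `κ > 0`; the output is exactly the functional chain consumed by
`DiffHurwitz.routh_tn`.  Proof: sign counting between the zeros (`FallingMesh.sign_prod`), the intermediate
value theorem, Lagrange uniqueness for the product forms (`FallingMesh.eq_prod_of_roots`).
-/

namespace Summit.CriticalPhenomena.PercolationContinuityZ3.Theorems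

namespace DiffHurwitz

open Finset Polynomial FallingMesh

/-- Opposite strict signs certified by a common sign factor give a sign change. -/
theorem mul_neg_of_signs (e u v : ℝ) (h1 : 0 < e * -1 * u) (h2 : 0 < e * v) : u * v < 0 := by
  have h3 := mul_pos h1 h2
  have : e * -1 * u * (e * v) = -(e ^ 2 * (u * v)) := by ring
  rw [this] at h3
  have he : 0 < e ^ 2 := by
    rcases eq_or_ne e 0 with h0 | h0
    · rw [h0] at h2; simp at h2
    · positivity
  nlinarith

/-- Cancellation of leading terms: if `f, g` have the same degree `n+1` and leading coefficient then
`deg (f - g) ≤ n`. -/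
theorem degree_sub_le_of_cancel (f g : ℝ[X]) (n : ℕ) (hf : f.natDegree = n + 1) (hg : g.natDegree = n + 1)
    (hfg : f.leadingCoeff = g.leadingCoeff) : (f - g).degree ≤ n := by
  have hf0 : f ≠ 0 := fun h0 => by rw [h0, natDegree_zero] at hf; omega
  have hg0 : g ≠ 0 := fun h0 => by rw [h0, natDegree_zero] at hg; omega
  by_cases hD : f - g = 0
  · rw [hD, degree_zero]; exact bot_le
  · have hfd : f.degree = ((n + 1 : ℕ) : WithBot ℕ) := by rw [degree_eq_natDegree hf0, hf]
    have hgd : g.degree = ((n + 1 : ℕ) : WithBot ℕ) := by rw [degree_eq_natDegree hg0, hg]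
    have hlt := degree_sub_lt (hfd.trans hgd.symm) hf0 hfg
    have h1 := natDegree_lt_natDegree hD hlt
    rw [hf] at h1
    exact degree_le_of_natDegree_le (by omega)

/-- **The discrete Routh chain exists under the gapped interlacing invariant J.** -/
theorem routhChain_exists : ∀ (k : ℕ) (lp lq : ℝ) (α γ : ℕ → ℝ), 0 < lp → 0 < lq → α k < 0 →
    (∀ i, i < k → α i - 1 < γ i ∧ γ i < α (i + 1) - 1) →
    ∃ (ps qs : ℕ → ℝ → ℝ) (cs cs' : ℕ → ℝ) (κ : ℝ), 0 < κ ∧ (∀ j, 0 ≤ cs j) ∧ (∀ j, 0 ≤ cs' j) ∧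
      (∀ x, ps 0 x = lp * ∏ i ∈ range (k + 1), (x - α i)) ∧
      (∀ x, qs 0 x = lq * ∏ i ∈ range k, (x - γ i)) ∧
      (∀ j, j < k + 1 → ∀ x, ps j x = ps (j + 1) x + cs j * (x * qs j (x - 1))) ∧
      (∀ j, j < k + 1 → ∀ x, qs j x = qs (j + 1) x + cs' j * ps (j + 1) (x + 1)) ∧
      (∀ x, ps (k + 1) x = κ) ∧ (∀ x, qs (k + 1) x = 0) := by
  intro k
  induction k with
  | zero =>
    intro lp lq α γ hlp hlq hα _
    have hκ : 0 < -lp * α 0 := by nlinarith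
    refine ⟨fun j x => if j = 0 then lp * (x - α 0) else -lp * α 0,
      fun j x => if j = 0 then lq else 0, fun _ => lp / lq, fun _ => lq / (-lp * α 0), -lp * α 0,
      hκ, fun _ => (div_pos hlp hlq).le, fun _ => (div_pos hlq hκ).le,
      fun x => by simp, fun x => by simp, fun j hj x => ?_, fun j hj x => ?_, fun x => by simp, fun x => by simp⟩
    · rw [show j = 0 by omega]; dsimp only; rw [if_pos rfl, if_pos rfl, if_neg (Nat.succ_ne_zero 0)]
      field_simp; ring
    · rw [show j = 0 by omega]; dsimp only
      rw [if_pos rfl, if_neg (Nat.succ_ne_zero 0), if_neg (Nat.succ_ne_zero 0)]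
      have hα0 : α 0 ≠ 0 := ne_of_lt hα
      have hlp0 : lp ≠ 0 := ne_of_gt hlp
      field_simp; ring
  | succ k ih =>
    intro lp lq α γ hlp hlq hαneg hJ
    -- sortedness consequences of J
    have hαmono : ∀ i j, i < j → j ≤ k + 1 → α i < α j := by
      intro i j hij hjk
      induction j with
      | zero => exact absurd hij (by omega)
      | succ j ihj =>
        have hJj := hJ j (by omega)
        rcases Nat.lt_or_ge i j with h' | h'
        · have := ihj h' (by omega); linarith [hJj.1, hJj.2]
        · rw [show i = j by omega]; linarith [hJj.1, hJj.2]
    have hαle : ∀ i j, i ≤ j → j ≤ k + 1 → α i ≤ α j := by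
      intro i j hij hjk
      rcases Nat.lt_or_ge i j with h' | h'
      · exact (hαmono i j h' hjk).le
      · rw [show i = j by omega]
    have hγmono : ∀ i j, i < j → j < k + 1 → γ i < γ j := by
      intro i j hij hjk
      linarith [(hJ i (by omega)).2, (hJ j hjk).1, hαle (i + 1) j (by omega) (by omega)]
    have hγle : ∀ i j, i ≤ j → j < k + 1 → γ i ≤ γ j := by
      intro i j hij hjk
      rcases Nat.lt_or_ge i j with h' | h'
      · exact (hγmono i j h' hjk).le
      · rw [show i = j by omega]
    have hαneg' : ∀ i, i ≤ k + 1 → α i < 0 := fun i hi => lt_of_le_of_lt (hαle i (k + 1) hi le_rfl) hαneg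
    obtain ⟨p, hp⟩ : ∃ p : ℝ[X], p = C lp * ∏ i ∈ range (k + 1 + 1), (X - C (α i)) := ⟨_, rfl⟩
    obtain ⟨qt, hqt⟩ : ∃ qt : ℝ[X], qt = C lq * ∏ i ∈ range (k + 1), (X - C (γ i)) := ⟨_, rfl⟩
    obtain ⟨qts, hqts⟩ : ∃ qts : ℝ[X], qts = C lq * ∏ i ∈ range (k + 1), (X - C (γ i + 1)) := ⟨_, rfl⟩
    have hqts_ev : ∀ y, qts.eval y = lq * ∏ i ∈ range (k + 1), (y - 1 - γ i) := by
      intro y; rw [hqts, prodForm_eval]; congr 1; exact prod_congr rfl fun i _ => by ring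
    ------------------------------------------------------------------ STEP A
    obtain ⟨c, hc⟩ : ∃ c : ℝ, c = lp / lq := ⟨_, rfl⟩
    have hcpos : 0 < c := by rw [hc]; exact div_pos hlp hlq
    have hclq : c * lq = lp := by rw [hc]; field_simp
    obtain ⟨p₁, hp₁⟩ : ∃ p₁ : ℝ[X], p₁ = p - C c * (X * qts) := ⟨_, rfl⟩
    have hev₁ : ∀ y, p₁.eval y = lp * ∏ i ∈ range (k + 1 + 1), (y - α i)
        - c * (y * (lq * ∏ i ∈ range (k + 1), (y - 1 - γ i))) := by
      intro y; rw [hp₁, eval_sub, hp, prodForm_eval, eval_mul, eval_C, eval_mul, eval_X, hqts_ev]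
    have hsA1 : ∀ j, j < k + 1 → 0 < (-1 : ℝ) ^ (k + 1 - j) * p₁.eval (γ j + 1) := by
      intro j hj
      have hz : ∏ i ∈ range (k + 1), (γ j + 1 - 1 - γ i) = 0 := prod_eq_zero (mem_range.2 hj) (by ring)
      have hs := sign_prod (k + 1 + 1) (k + 1 - j) α (γ j + 1) (by omega)
        (fun i hi => by linarith [hαle i j (by omega) (by omega), (hJ j hj).1])
        (fun i hi hi' => by linarith [hαle (j + 1) i (by omega) (by omega), (hJ j hj).2])
      rw [hev₁, hz]; simp only [mul_zero, sub_zero]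
      rw [show (-1 : ℝ) ^ (k + 1 - j) * (lp * ∏ i ∈ range (k + 1 + 1), (γ j + 1 - α i))
        = lp * ((-1 : ℝ) ^ (k + 1 - j) * ∏ i ∈ range (k + 1 + 1), (γ j + 1 - α i)) by ring]
      exact mul_pos hlp hs
    have hsA2 : ∀ j, j < k + 1 + 1 → 0 < (-1 : ℝ) ^ (k + 1 - j) * p₁.eval (α j) := by
      intro j hj
      have hz : ∏ i ∈ range (k + 1 + 1), (α j - α i) = 0 := prod_eq_zero (mem_range.2 hj) (sub_self _)
      have hs := sign_prod (k + 1) (k + 1 - j) γ (α j - 1) (by omega)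
        (fun i hi => by linarith [(hJ i (by omega)).2, hαle (i + 1) j (by omega) (by omega)])
        (fun i hi hi' => by linarith [(hJ i hi').1, hαle j i (by omega) (by omega)])
      rw [hev₁, hz, mul_zero, zero_sub]
      have hαj := hαneg' j (by omega)
      rw [show (-1 : ℝ) ^ (k + 1 - j) * -(c * (α j * (lq * ∏ i ∈ range (k + 1), (α j - 1 - γ i))))
        = (c * (-α j) * lq) * ((-1 : ℝ) ^ (k + 1 - j) * ∏ i ∈ range (k + 1), (α j - 1 - γ i)) by ring]
      exact mul_pos (mul_pos (mul_pos hcpos (by linarith)) hlq) hs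
    have hexA : ∀ j, j < k + 1 → ∃ x, γ j + 1 < x ∧ x < α (j + 1) ∧ p₁.eval x = 0 := by
      intro j hj
      apply exists_root_of_sign_change _ p₁.continuous _ _ (by linarith [(hJ j hj).2])
      have h1 := hsA1 j hj
      have h2 := hsA2 (j + 1) (by omega)
      rw [show (-1 : ℝ) ^ (k + 1 - j) = (-1) ^ (k + 1 - (j + 1)) * (-1) by
        rw [← pow_succ, show k + 1 - (j + 1) + 1 = k + 1 - j by omega]] at h1
      exact mul_neg_of_signs _ _ _ h1 h2
    choose! α' hα' using hexA
    have hα'1 : ∀ j, j < k + 1 → γ j + 1 < α' j := fun j hj => (hα' j hj).1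
    have hα'2 : ∀ j, j < k + 1 → α' j < α (j + 1) := fun j hj => (hα' j hj).2.1
    have hα'3 : ∀ j, j < k + 1 → p₁.eval (α' j) = 0 := fun j hj => (hα' j hj).2.2
    have hα'mono : ∀ i j, i < j → j < k + 1 → α' i < α' j := by
      intro i j hij hjk
      linarith [hα'2 i (by omega), hα'1 j hjk, (hJ j hjk).1, hαle (i + 1) j (by omega) (by omega)]
    have hα'le : ∀ i j, i ≤ j → j < k + 1 → α' i ≤ α' j := by
      intro i j hij hjk
      rcases Nat.lt_or_ge i j with h' | h'
      · exact (hα'mono i j h' hjk).le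
      · rw [show i = j by omega]
    have hα'top : ∀ j, j < k + 1 → α' j < α (k + 1) :=
      fun j hj => lt_of_lt_of_le (hα'2 j hj) (hαle (j + 1) (k + 1) (by omega) le_rfl)
    -- degree of p₁ and its product form
    obtain ⟨hpnd, hplc⟩ := prodForm_natDegree lp (ne_of_gt hlp) α (k + 1 + 1)
    rw [← hp] at hpnd hplc
    obtain ⟨G₁, hG₁⟩ : ∃ G₁ : ℝ[X], G₁ = C c * (X * qts) := ⟨_, rfl⟩
    have hδ : ∀ i ∈ range (k + 1), (X - C (if i < k + 1 then γ i + 1 else 0) : ℝ[X]) = X - C (γ i + 1) :=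
      fun i hi => by rw [if_pos (mem_range.1 hi)]
    have hG₁form : G₁ = C (c * lq) * ∏ i ∈ range (k + 1 + 1),
        (X - C (if i < k + 1 then γ i + 1 else 0)) := by
      rw [hG₁, hqts, prod_range_succ _ (k + 1), if_neg (lt_irrefl _), C_0, sub_zero, C_mul,
        prod_congr rfl hδ]
      ring
    obtain ⟨hG₁nd, hG₁lc⟩ := prodForm_natDegree (c * lq) (ne_of_gt (mul_pos hcpos hlq))
      (fun i => if i < k + 1 then γ i + 1 else 0) (k + 1 + 1)
    rw [← hG₁form] at hG₁nd hG₁lc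
    have hp₁deg : p₁.degree ≤ (k + 1 : ℕ) := by
      rw [hp₁, ← hG₁]
      exact degree_sub_le_of_cancel p G₁ (k + 1) hpnd hG₁nd (by rw [hplc, hG₁lc, hclq])
    have hp₁form := eq_prod_of_roots (k + 1) p₁ hp₁deg α' hα'mono hα'3 (α (k + 1)) hα'top
    obtain ⟨lp₁, hlp₁⟩ : ∃ lp₁ : ℝ, lp₁ = p₁.eval (α (k + 1)) / ∏ j ∈ range (k + 1), (α (k + 1) - α' j) :=
      ⟨_, rfl⟩
    rw [← hlp₁] at hp₁form
    have hlp₁pos : 0 < lp₁ := by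
      rw [hlp₁]
      refine div_pos ?_ (prod_pos fun j hj => by rw [mem_range] at hj; linarith [hα'top j hj])
      have := hsA2 (k + 1) (by omega); rwa [Nat.sub_self, pow_zero, one_mul] at this
    have hev₁' : ∀ y, p₁.eval y = lp₁ * ∏ j ∈ range (k + 1), (y - α' j) := by
      intro y; rw [hp₁form, prodForm_eval]
    ------------------------------------------------------------------ STEP B
    obtain ⟨c', hc'⟩ : ∃ c' : ℝ, c' = lq / lp₁ := ⟨_, rfl⟩
    have hc'pos : 0 < c' := by rw [hc']; exact div_pos hlq hlp₁pos
    have hc'lp : c' * lp₁ = lq := by rw [hc']; field_simp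
    obtain ⟨p₁s, hp₁s⟩ : ∃ p₁s : ℝ[X], p₁s = C lp₁ * ∏ j ∈ range (k + 1), (X - C (α' j - 1)) := ⟨_, rfl⟩
    have hp₁s_ev : ∀ y, p₁s.eval y = lp₁ * ∏ j ∈ range (k + 1), (y + 1 - α' j) := by
      intro y; rw [hp₁s, prodForm_eval]; congr 1; exact prod_congr rfl fun i _ => by ring
    obtain ⟨q₂, hq₂⟩ : ∃ q₂ : ℝ[X], q₂ = qt - C c' * p₁s := ⟨_, rfl⟩
    have hev₂ : ∀ y, q₂.eval y = lq * ∏ i ∈ range (k + 1), (y - γ i)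
        - c' * (lp₁ * ∏ j ∈ range (k + 1), (y + 1 - α' j)) := by
      intro y; rw [hq₂, eval_sub, hqt, prodForm_eval, eval_mul, eval_C, hp₁s_ev]
    have hsB1 : ∀ j, j < k + 1 → 0 < (-1 : ℝ) ^ (k - j) * q₂.eval (α' j - 1) := by
      intro j hj
      have hz : ∏ i ∈ range (k + 1), (α' j - 1 + 1 - α' i) = 0 := prod_eq_zero (mem_range.2 hj) (by ring)
      have hs := sign_prod (k + 1) (k - j) γ (α' j - 1) (by omega)
        (fun i hi => by linarith [hγle i j (by omega) hj, hα'1 j hj])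
        (fun i hi hi' => by
          linarith [hα'2 j hj, (hJ (j + 1) (by omega)).1, hγle (j + 1) i (by omega) hi'])
      rw [hev₂, hz]; simp only [mul_zero, sub_zero]
      rw [show (-1 : ℝ) ^ (k - j) * (lq * ∏ i ∈ range (k + 1), (α' j - 1 - γ i))
        = lq * ((-1 : ℝ) ^ (k - j) * ∏ i ∈ range (k + 1), (α' j - 1 - γ i)) by ring]
      exact mul_pos hlq hs
    have hsB2 : ∀ j, j < k + 1 → 0 < (-1 : ℝ) ^ (k - j) * q₂.eval (γ j) := by
      intro j hj
      have hz : ∏ i ∈ range (k + 1), (γ j - γ i) = 0 := prod_eq_zero (mem_range.2 hj) (sub_self _)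
      have hs := sign_prod (k + 1) (k + 1 - j) α' (γ j + 1) (by omega)
        (fun i hi => by linarith [hα'2 i (by omega), (hJ j hj).1, hαle (i + 1) j (by omega) (by omega)])
        (fun i hi hi' => by linarith [hα'le j i (by omega) hi', hα'1 j hj])
      rw [hev₂, hz, mul_zero, zero_sub]
      rw [show (-1 : ℝ) ^ (k - j) * -(c' * (lp₁ * ∏ i ∈ range (k + 1), (γ j + 1 - α' i)))
        = (c' * lp₁) * ((-1 : ℝ) ^ (k - j) * (-1) * ∏ i ∈ range (k + 1), (γ j + 1 - α' i)) by ring,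
        show (-1 : ℝ) ^ (k - j) * (-1) = (-1) ^ (k + 1 - j) by
          rw [← pow_succ, show k - j + 1 = k + 1 - j by omega]]
      exact mul_pos (mul_pos hc'pos hlp₁pos) hs
    have hexB : ∀ j, j < k → ∃ x, α' j - 1 < x ∧ x < γ (j + 1) ∧ q₂.eval x = 0 := by
      intro j hj
      apply exists_root_of_sign_change _ q₂.continuous _ _
        (by linarith [hα'2 j (by omega), (hJ (j + 1) (by omega)).1])
      have h1 := hsB1 j (by omega)
      have h2 := hsB2 (j + 1) (by omega)
      rw [show (-1 : ℝ) ^ (k - j) = (-1) ^ (k - (j + 1)) * (-1) by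
        rw [← pow_succ, show k - (j + 1) + 1 = k - j by omega]] at h1
      exact mul_neg_of_signs _ _ _ h1 h2
    choose! γ' hγ' using hexB
    have hγ'mono : ∀ i j, i < j → j < k → γ' i < γ' j := by
      intro i j hij hjk
      linarith [(hγ' i (by omega)).2.1, (hγ' j hjk).1, hα'1 j (by omega), hγle (i + 1) j (by omega) (by omega)]
    have hxk : ∀ j, j < k → γ' j < α' k - 1 := by
      intro j hj
      linarith [(hγ' j hj).2.1, hα'1 k (by omega), hγle (j + 1) k (by omega) (by omega)]
    -- degree of q₂ and its product form
    obtain ⟨hqnd, hqlc⟩ := prodForm_natDegree lq (ne_of_gt hlq) γ (k + 1)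
    rw [← hqt] at hqnd hqlc
    obtain ⟨hG₂nd, hG₂lc⟩ := prodForm_natDegree (c' * lp₁) (ne_of_gt (mul_pos hc'pos hlp₁pos))
      (fun j => α' j - 1) (k + 1)
    have hG₂form : C c' * p₁s = C (c' * lp₁) * ∏ j ∈ range (k + 1), (X - C (α' j - 1)) := by
      rw [hp₁s, ← mul_assoc, ← C_mul]
    rw [← hG₂form] at hG₂nd hG₂lc
    have hq₂deg : q₂.degree ≤ (k : ℕ) := by
      rw [hq₂]
      exact degree_sub_le_of_cancel qt (C c' * p₁s) k hqnd hG₂nd (by rw [hqlc, hG₂lc, hc'lp])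
    have hq₂form := eq_prod_of_roots k q₂ hq₂deg γ' hγ'mono (fun j hj => (hγ' j hj).2.2) (α' k - 1) hxk
    obtain ⟨lq₂, hlq₂⟩ : ∃ lq₂ : ℝ, lq₂ = q₂.eval (α' k - 1) / ∏ j ∈ range k, (α' k - 1 - γ' j) := ⟨_, rfl⟩
    rw [← hlq₂] at hq₂form
    have hlq₂pos : 0 < lq₂ := by
      rw [hlq₂]
      refine div_pos ?_ (prod_pos fun j hj => by rw [mem_range] at hj; linarith [hxk j hj])
      have := hsB1 k (by omega); rwa [Nat.sub_self, pow_zero, one_mul] at this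
    have hev₂' : ∀ y, q₂.eval y = lq₂ * ∏ j ∈ range k, (y - γ' j) := by
      intro y; rw [hq₂form, prodForm_eval]
    ------------------------------------------------------------------ recursion
    obtain ⟨ps, qs, cs, cs', κ, hκ, hcs, hcs', hps0, hqs0, hrecA, hrecB, hpsT, hqsT⟩ :=
      ih lp₁ lq₂ α' γ' hlp₁pos hlq₂pos (by linarith [hα'2 k (by omega)])
        (fun i hi => ⟨(hγ' i hi).1, by linarith [(hγ' i hi).2.1, hα'1 (i + 1) (by omega)]⟩)
    have hlink1 : ∀ x, p.eval x = p₁.eval x + c * (x * qt.eval (x - 1)) := by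
      intro x; rw [hev₁, hp, prodForm_eval, hqt, prodForm_eval]; ring
    have hlink2 : ∀ x, qt.eval x = q₂.eval x + c' * p₁.eval (x + 1) := by
      intro x; rw [hev₂, hqt, prodForm_eval, hev₁']; ring
    refine ⟨fun j => if j = 0 then (fun x => p.eval x) else ps (j - 1),
      fun j => if j = 0 then (fun x => qt.eval x) else qs (j - 1),
      fun j => if j = 0 then c else cs (j - 1), fun j => if j = 0 then c' else cs' (j - 1), κ, hκ,
      fun j => ?_, fun j => ?_, fun x => ?_, fun x => ?_, fun j hj x => ?_, fun j hj x => ?_,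
      fun x => ?_, fun x => ?_⟩
    · dsimp only; split_ifs
      · exact hcpos.le
      · exact hcs _
    · dsimp only; split_ifs
      · exact hc'pos.le
      · exact hcs' _
    · dsimp only; rw [if_pos rfl, hp, prodForm_eval]
    · dsimp only; rw [if_pos rfl, hqt, prodForm_eval]
    · dsimp only
      rcases j with _ | j
      · rw [if_pos rfl, if_neg (Nat.succ_ne_zero 0), if_pos rfl, if_pos rfl, show 0 + 1 - 1 = 0 by omega,
          hps0, ← hev₁']
        exact hlink1 x
      · rw [if_neg (Nat.succ_ne_zero j), if_neg (by omega), if_neg (Nat.succ_ne_zero j),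
          if_neg (Nat.succ_ne_zero j), Nat.add_sub_cancel, show j + 1 + 1 - 1 = j + 1 by omega]
        exact hrecA j (by omega) x
    · dsimp only
      rcases j with _ | j
      · rw [if_pos rfl, if_neg (Nat.succ_ne_zero 0), if_pos rfl, if_neg (Nat.succ_ne_zero 0),
          show 0 + 1 - 1 = 0 by omega, hqs0, ← hev₂', hps0, ← hev₁']
        exact hlink2 x
      · rw [if_neg (Nat.succ_ne_zero j), if_neg (by omega), if_neg (Nat.succ_ne_zero j),
          if_neg (by omega), Nat.add_sub_cancel, show j + 1 + 1 - 1 = j + 1 by omega]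
        exact hrecB j (by omega) x
    · dsimp only; rw [if_neg (by omega), show k + 1 + 1 - 1 = k + 1 by omega]; exact hpsT x
    · dsimp only; rw [if_neg (by omega), show k + 1 + 1 - 1 = k + 1 by omega]; exact hqsT x

end DiffHurwitz

end Summit.CriticalPhenomena.PercolationContinuityZ3.Theorems
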